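import Summits.BirchSwinnertonDyer.BirchSwinnertonDyer.Theses.TameQuarticManinParity
import Summits.BirchSwinnertonDyer.BirchSwinnertonDyer.Theorems.TameQuarticManinParityIrrManinLeOfOrientation
import Summits.BirchSwinnertonDyer.BirchSwinnertonDyer.Theorems.TameQuarticManinParityTwistPartnerOptimalDatumOfFacts
import Summits.BirchSwinnertonDyer.BirchSwinnertonDyer.Theorems.TameQuarticManinParityOptimalTwistNeronLatticeOfSplit
import Summits.BirchSwinnertonDyer.BirchSwinnertonDyer.Theorems.TameQuarticManinParityTwistPairManinDivisibility
import Summits.BirchSwinnertonDyer.BirchSwinnertonDyer.Theorems.ManinLocalTwoThreeManinPrimeToAdditiveFiveLeDegreeUpThirteenOfOrdinaryTwistLaw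
import HarnessLib

/-!
# Route `TameQuarticManinParity`, LINE 26 (bsd-idea-3 g8), glue GD26 `TprimeIrrTwistLatticeDichotomyOfOptimalTwist`
# (stmt-BirchSwinnertonDyer-23051) — PROVED BY NAME (planner's proof, landed by the prover seat), and D24
# `TprimeIrrTwistLatticeDichotomy` (stmt-22544) GRANTED {modularity, Dokchitser–Dokchitser} only

Cell `pub/bsd-wall`, D-0145 line `route-BirchSwinnertonDyer-TeichmullerTwistDescent`, seat `bsd-line-ttd-p1` g10. The
PROOF of the glue (Parts A/B below: lattice algebra on optimal pairs, X22 applied twice, newform identification of the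
twist by `cuspCoeff_eq_chi_mul_of_twist_pStar`, uniqueness of the primitive quadratic character mod `3`, level transport
by `subst`) is planner bsd-idea-3 g8's (`ideas/l26/GD26_…_PROVED_byname.lean`, 18:03Z), re-checked against the tree and
wrapped in the Theorems conventions (D-0016); the Gauss-sum lemma is imported from
`TameQuarticManinParityOptimalTwistNeronLatticeOfSplit`. NEW here: the corollary
`tprimeIrrTwistLatticeDichotomy_of_modularity_of_dokchitser : exists_isNewformOf → dokchitser_… → D24`, since T24L and
M25 are theorems of the tree (LINE 25 chain, this seat). BSD is NOT proved by this; Manin's conjecture is not proved;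
D24 itself stays OPEN as typed (conditional on the two published cite-only facts); N24/O22 untouched.
-/

noncomputable section

set_option autoImplicit false
-- D-0017: single-problem summit, so `Summit.BirchSwinnertonDyer.BirchSwinnertonDyer.…` repeats a namespace BY DESIGN.
set_option linter.dupNamespace false

namespace Summit.BirchSwinnertonDyer.BirchSwinnertonDyer.Theorems.TameQuarticManinParity

open Summit.BirchSwinnertonDyer.BirchSwinnertonDyer.Theses.TameQuarticManinParity

open Literature.NumberTheory.EllipticCurves.ModularForms WeierstrassCurve

/-- **Part A.** T24L ∧ M25 ⇒ the D24 disjunction on optimal type-III pairs. -/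
theorem pairTwistLatticeDichotomy_of_T24L_M25 :
    TprimeIrrOptimalTwistNeronLattice → TprimeIrrTwistPairManinDivisibility →
      (∀ (W : WeierstrassCurve ℚ) [W.IsElliptic] [W.IsGloballyMinimal] [NeZero (W.conductorNorm ℤ)], ¬ W.HasCM → Literature.NumberTheory.EllipticCurves.Rank1Residual.Addv W 3 → Summit.BirchSwinnertonDyer.Rank1Residual.Additive.SubTprime W 3 → W.HasIrreducibleModPGaloisRep 3 → padicValInt 3 W.minimalDiscriminantInt = 3 → ∀ (D : Literature.NumberTheory.EllipticCurves.ModularForms.ModularParametrizationData W (W.conductorNorm ℤ)), (∀ z ∈ D.L.lattice, ∃ w ∈ Literature.NumberTheory.EllipticCurves.ModularForms.periodLattice D.f, z = D.c * w) → (∀ (W' : WeierstrassCurve ℚ) [W'.IsElliptic] (D₁ : Literature.NumberTheory.EllipticCurves.ModularForms.ModularParametrizationData W' (W.conductorNorm ℤ)), D₁.f = D.f → D.modularDegree ≤ D₁.modularDegree) → ∀ (h9 : 3 ^ 2 ∣ W.conductorNorm ℤ) (χ : DirichletCharacter ℂ 3) (hχ : χ.IsQuadratic), χ.IsPrimitive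 → ∀ (A : WeierstrassCurve ℚ) [A.IsElliptic] [A.IsGloballyMinimal] (D' : Literature.NumberTheory.EllipticCurves.ModularForms.ModularParametrizationData A (W.conductorNorm ℤ)), D'.f = Literature.NumberTheory.EllipticCurves.ModularForms.charTwist (W.conductorNorm ℤ) (dvd_refl _) h9 hχ D.f → (∀ z ∈ D'.L.lattice, ∃ w ∈ Literature.NumberTheory.EllipticCurves.ModularForms.periodLattice D'.f, z = D'.c * w) → (∀ (W'' : WeierstrassCurve ℚ) [W''.IsElliptic] (D₁ : Literature.NumberTheory.EllipticCurves.ModularForms.ModularParametrizationData W'' (W.conductorNorm ℤ)), D₁.f = D'.f → D'.modularDegree ≤ D₁.modularDegree) → ((∀ z ∈ Literature.NumberTheory.EllipticCurves.ModularForms.periodLattice D.f, ∃ w ∈ Literature.NumberTheory.EllipticCurves.ModularForms.periodLattice (Literature.NumberTheory.EllipticCurves.ModularForms.charTwist (W.conductorNorm ℤ) (dvd_refl _) h9 hχ D.f), z = gaussSum χ (ZMod.stdAddChar (N := 3)) * w) ∨ (∀ w ∈ Literature.NumberTheory.EllipticCurves.ModularForms.periodLattice (Literature.NumberTheory.EllipticCurves.ModularForms.charTwist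 (W.conductorNorm ℤ) (dvd_refl _) h9 hχ D.f), ∃ z ∈ Literature.NumberTheory.EllipticCurves.ModularForms.periodLattice D.f, w = gaussSum χ (ZMod.stdAddChar (N := 3)) * z))) := by
  intro hT hM W _ _ _ hcm hadd ht hirr h3 D hex hmin h9 χ hχ hprim A _ _ D' hf hex' hmin'
  have hiff := hT W hcm hadd ht hirr h3 D hex hmin h9 χ hχ hprim A D' hf hex' hmin'
  obtain ⟨⟨k, hk⟩, ⟨m, hm⟩⟩ := hM W hcm hadd ht hirr h3 D hex hmin h9 χ hχ hprim A D' hf hex' hmin'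
  have hG2 : gaussSum χ (ZMod.stdAddChar (N := 3)) ^ 2 = -3 := gaussSum_sq_eq_neg_three χ hχ hprim
  rw [← hf]
  generalize hG : gaussSum χ (ZMod.stdAddChar (N := 3)) = G at hiff hG2 ⊢
  have hG0 : G ≠ 0 := by intro h; rw [h] at hG2; norm_num at hG2
  have hc : D.c ≠ 0 := D.maninConstant_ne_zero_holds
  have hc' : D'.c ≠ 0 := D'.maninConstant_ne_zero_holds
  have hcℂ : (D.c : ℂ) ≠ 0 := by exact_mod_cast hc
  have hc'ℂ : (D'.c : ℂ) ≠ 0 := by exact_mod_cast hc'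
  -- `k * m = 3`, so `k = ±1` or `k = ±3`
  have hkm : k * m = 3 := by
    have : D'.c * (k * m) = D'.c * 3 := by rw [← mul_assoc, ← hk, ← hm]; ring
    exact mul_left_cancel₀ hc' this
  have hk' : k = 1 ∨ k = -1 ∨ k = 3 ∨ k = -3 := by
    have hdvd : k ∣ 3 := ⟨m, hkm.symm⟩
    have hnat : k.natAbs ∣ 3 := by exact_mod_cast Int.natAbs_dvd_natAbs.mpr hdvd
    have h3 : k.natAbs = 1 ∨ k.natAbs = 3 := by
      have := (Nat.dvd_prime Nat.prime_three).mp hnat; exact this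
    rcases h3 with h1 | h3
    · rcases Int.natAbs_eq k with h | h <;> rw [h1] at h <;> [exact Or.inl (by simpa using h); exact Or.inr (Or.inl (by simpa using h))]
    · rcases Int.natAbs_eq k with h | h <;> rw [h3] at h <;> [exact Or.inr (Or.inr (Or.inl (by simpa using h))); exact Or.inr (Or.inr (Or.inr (by simpa using h)))]
  -- the two shapes
  have caseA : ∀ ε : ℤ, (ε = 1 ∨ ε = -1) → D.c = D'.c * ε →
      ∀ z ∈ periodLattice D.f, ∃ w ∈ periodLattice D'.f, z = G * w := by
    intro ε hε hcε z hz
    -- `w := z / G`; `D'.c w ∈ Λ(A)` iff `G D'.c w = D'.c z ∈ Λ(W)`, and `D'.c z = ± D.c z ∈ Λ(W)`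
    have h1 : (D.c : ℂ) * z ∈ D.L.lattice := D.smul_periodLattice_le z hz
    have h2 : (D'.c : ℂ) * z ∈ D.L.lattice := by
      rcases hε with rfl | rfl
      · simpa [hcε] using h1
      · have : (D'.c : ℂ) * z = -((D.c : ℂ) * z) := by rw [hcε]; push_cast; ring
        rw [this]; exact neg_mem h1
    have h3 : (D'.c : ℂ) * (z / G) ∈ D'.L.lattice := by
      rw [hiff]; convert h2 using 1; field_simp
    obtain ⟨w, hw, hw'⟩ := hex' _ h3
    refine ⟨w, hw, ?_⟩
    have : z / G = w := mul_left_cancel₀ hc'ℂ hw'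
    rw [← this, mul_div_cancel₀ z hG0]
  have caseB : ∀ ε : ℤ, (ε = 1 ∨ ε = -1) → D.c = D'.c * (3 * ε) →
      ∀ w ∈ periodLattice D'.f, ∃ z ∈ periodLattice D.f, w = G * z := by
    intro ε hε hcε w hw
    -- `z := w / G = -G w / 3`; `D.c z = ±3 D'.c (-G w/3) = ∓ G D'.c w ∈ Λ(W)` since `D'.c w ∈ Λ(A)`
    have h1 : (D'.c : ℂ) * w ∈ D'.L.lattice := D'.smul_periodLattice_le w hw
    have h2 : G * ((D'.c : ℂ) * w) ∈ D.L.lattice := (hiff _).mp h1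
    have hGinv : w / G = -(G * w) / 3 := by
      rw [div_eq_iff hG0]
      linear_combination (w / 3) * hG2
    have h3 : (D.c : ℂ) * (w / G) ∈ D.L.lattice := by
      rcases hε with rfl | rfl
      · have : (D.c : ℂ) * (w / G) = -(G * ((D'.c : ℂ) * w)) := by
          rw [hcε, hGinv]; push_cast; ring
        rw [this]; exact neg_mem h2
      · have : (D.c : ℂ) * (w / G) = G * ((D'.c : ℂ) * w) := by
          rw [hcε, hGinv]; push_cast; ring
        rw [this]; exact h2
    obtain ⟨z, hz, hz'⟩ := hex _ h3
    refine ⟨z, hz, ?_⟩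
    have : w / G = z := mul_left_cancel₀ hcℂ hz'
    rw [← this, mul_div_cancel₀ w hG0]
  rcases hk' with h | h | h | h
  · exact Or.inl (caseA 1 (Or.inl rfl) (by rw [hk, h]))
  · exact Or.inl (caseA (-1) (Or.inr rfl) (by rw [hk, h]))
  · exact Or.inr (caseB 1 (Or.inl rfl) (by rw [hk, h]; ring))
  · exact Or.inr (caseB (-1) (Or.inr rfl) (by rw [hk, h]; ring))

/-! ## Part B: double X22 + newform identification ⇒ D24 for every `W`, `D` -/

section PartB

open scoped Classical
open IsDedekindDomain Rat.HeightOneSpectrum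
  Literature.NumberTheory.EllipticCurves Literature.NumberTheory.EllipticCurves.ModularForms
  Literature.NumberTheory.EllipticCurves.Rank1Residual
  Summit.BirchSwinnertonDyer.Rank1Residual Summit.BirchSwinnertonDyer.Rank1Residual.Additive
  Summit.BirchSwinnertonDyer.Rank1Residual.ManinAdditive
  Summit.BirchSwinnertonDyer.BirchSwinnertonDyer.Theorems.TameQuarticManinParity

/-- A primitive quadratic character mod `3` takes the value `−1` at `2 = −1`. -/
theorem apply_two_eq_neg_one (χ : DirichletCharacter ℂ 3) (hχ : χ.IsQuadratic) (hprim : χ.IsPrimitive) :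
    χ (2 : ZMod 3) = -1 := by
  have hne : χ ≠ 1 := by
    intro h
    have h1 : χ.conductor = 3 := hprim
    rw [h, DirichletCharacter.conductor_one] at h1
    norm_num at h1
  have h2 : (2 : ZMod 3) = -1 := by decide
  have hsq : χ (2 : ZMod 3) * χ (2 : ZMod 3) = 1 := by rw [← map_mul, h2]; norm_num
  rcases hχ (2 : ZMod 3) with h0 | h1 | hm
  · rw [h0, zero_mul] at hsq; exact absurd hsq zero_ne_one
  · exfalso
    obtain ⟨a, ha⟩ := MulChar.ne_one_iff.mp hne
    obtain ⟨b, hb⟩ : ∃ b : ZMod 3, b = (a : ZMod 3) := ⟨_, rfl⟩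
    fin_cases b
    · have hu : IsUnit ((a : ZMod 3)) := a.isUnit
      rw [← hb] at hu
      exact not_isUnit_zero hu
    · apply ha
      have : (a : ZMod 3) = 1 := by rw [← hb]; rfl
      rw [this, map_one]
    · apply ha
      have : (a : ZMod 3) = 2 := by rw [← hb]; rfl
      rw [this, h1]
  · exact hm

/-- **Uniqueness of the primitive quadratic character mod `3`.** -/
theorem eq_of_isQuadratic_isPrimitive_three (χ χ' : DirichletCharacter ℂ 3) (hχ : χ.IsQuadratic)
    (hprim : χ.IsPrimitive) (hχ' : χ'.IsQuadratic) (hprim' : χ'.IsPrimitive) : χ = χ' := by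
  apply MulChar.ext
  intro a
  obtain ⟨b, hb⟩ : ∃ b : ZMod 3, b = (a : ZMod 3) := ⟨_, rfl⟩
  fin_cases b
  · have hu : IsUnit ((a : ZMod 3)) := a.isUnit
    rw [← hb] at hu
    exact absurd hu not_isUnit_zero
  · have : (a : ZMod 3) = 1 := by rw [← hb]; rfl
    rw [this, map_one, map_one]
  · have : (a : ZMod 3) = 2 := by rw [← hb]; rfl
    rw [this, apply_two_eq_neg_one χ hχ hprim, apply_two_eq_neg_one χ' hχ' hprim']

/-- Transport of a lattice-optimal, degree-minimal datum along an equality of levels. -/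
theorem exists_transport_datum {A : WeierstrassCurve ℚ} [A.IsElliptic] {N N' : ℕ} [NeZero N] [NeZero N']
    (e : N = N') (D₀ : ModularParametrizationData A N)
    (hopt : ∀ z ∈ D₀.L.lattice, ∃ w ∈ periodLattice D₀.f, z = D₀.c * w)
    (hmin : ∀ (W₂ : WeierstrassCurve ℚ) [W₂.IsElliptic] (D₂ : ModularParametrizationData W₂ N),
      D₂.f = D₀.f → D₀.modularDegree ≤ D₂.modularDegree) :
    ∃ D' : ModularParametrizationData A N',
      (∀ z ∈ D'.L.lattice, ∃ w ∈ periodLattice D'.f, z = D'.c * w) ∧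
      (∀ (W'' : WeierstrassCurve ℚ) [W''.IsElliptic] (D₁ : ModularParametrizationData W'' N'),
        D₁.f = D'.f → D'.modularDegree ≤ D₁.modularDegree) ∧
      (∀ n : ℕ, cuspCoeff D'.f n = cuspCoeff D₀.f n) := by
  subst e
  exact ⟨D₀, hopt, fun W'' _ D₁ h ↦ hmin W'' D₁ h, fun _ ↦ rfl⟩

/-- The coefficient relations along `A ⊗ χ₋₃ ∼ W` (both additive at `3`): `aₙ(f_A) = χ₀(n) aₙ(f_W)` and
`aₙ(f_W) = χ₀(n) aₙ(f_A)`, for data at arbitrary levels. -/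
theorem cuspCoeff_rel_of_twist_negThree {W A : WeierstrassCurve ℚ} [W.IsElliptic] [A.IsElliptic]
    (haddW : Addv W 3) (haddA : Addv A 3) (hAW : IsIsogenous (A.quadraticTwist (-3 : ℚ)) W)
    {N N' : ℕ} [NeZero N] [NeZero N'] (D : ModularParametrizationData W N) (D' : ModularParametrizationData A N')
    (n : ℕ) :
    cuspCoeff D.f n = (quadraticChar (ZMod 3)).ringHomComp (Int.castRingHom ℂ) n * cuspCoeff D'.f n ∧
    cuspCoeff D'.f n = (quadraticChar (ZMod 3)).ringHomComp (Int.castRingHom ℂ) n * cuspCoeff D.f n := by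
  have hp2 : (3 : ℕ) ≠ 2 := by norm_num
  have e : ((-1 : ℚ) ^ (3 / 2) * 3) = -3 := by norm_num
  have ecast : ((((-1 : ℤ) ^ (3 / 2) * (3 : ℕ) : ℤ)) : ℚ) = (-1 : ℚ) ^ (3 / 2) * 3 := by norm_num
  have hd0 : ((-1 : ℚ) ^ (3 / 2) * 3) ≠ 0 := by norm_num
  haveI hAt : (A.quadraticTwist ((-1 : ℚ) ^ (3 / 2) * 3)).IsElliptic := A.isElliptic_quadraticTwist hd0
  have hAW' : IsIsogenous (A.quadraticTwist ((-1 : ℚ) ^ (3 / 2) * 3)) W := by rw [e]; exact hAW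
  have h1 : (1 : VariableChange ℚ) • A.quadraticTwist ((((-1 : ℤ) ^ (3 / 2) * (3 : ℕ) : ℤ)) : ℚ) =
      A.quadraticTwist ((-1 : ℚ) ^ (3 / 2) * 3) := by rw [one_smul, ecast]
  have hLA : (A.quadraticTwist ((-1 : ℚ) ^ (3 / 2) * 3)).LFunction = W.LFunction :=
    LFunction_eq_of_isIsogenous_holds _ W hAW'
  have hA0 : ∀ n : ℕ, 3 ∣ n → A.LFunction n = 0 := fun n hn ↦
    A.LFunction_apply_eq_zero_of_not_good_of_not_mult 3 haddA.1 haddA.2 hn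
  have hW0 : ∀ n : ℕ, 3 ∣ n → W.LFunction n = 0 := fun n hn ↦
    W.LFunction_apply_eq_zero_of_not_good_of_not_mult 3 haddW.1 haddW.2 hn
  exact ⟨cuspCoeff_eq_chi_mul_of_twist_pStar hp2 1 h1 hLA hW0 D' D n,
    cuspCoeff_eq_chi_mul_of_twist_pStar' hp2 1 h1 hLA hA0 D' D n⟩

/-- **Part B / main theorem.** X22 ∧ T24L ∧ M25 ⇒ D24 `TprimeIrrTwistLatticeDichotomy` (stmt-22544). -/
theorem tprimeIrrTwistLatticeDichotomy_of_partner_of_optimalTwist :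
    TprimeIrrTwistPartnerOptimalDatum → TprimeIrrOptimalTwistNeronLattice →
      TprimeIrrTwistPairManinDivisibility → TprimeIrrTwistLatticeDichotomy := by
  intro hX hT hM W _ _ _ hcm hadd ht hirr D h9 χ hχ hprim
  have hP := pairTwistLatticeDichotomy_of_T24L_M25 hT hM
  have hp2 : (3 : ℕ) ≠ 2 := by norm_num
  -- the character is `χ₀`
  obtain rfl := eq_of_isQuadratic_isPrimitive_three χ _ hχ hprim
    (isQuadratic_quadraticChar_ringHomComp 3) (isPrimitive_quadraticChar_ringHomComp 3 hp2)
  -- X22 twice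
  obtain ⟨A₁, _, _, _, hsum₁, hiso₁, hcm₁, hadd₁, ht₁, hirr₁, hN₁, D₁, hex₁, hmin₁⟩ := hX W hcm hadd ht hirr D
  obtain ⟨A₂, _, _, _, hsum₂, hiso₂, hcm₂, hadd₂, ht₂, hirr₂, hN₂, D₂, hex₂, hmin₂⟩ :=
    hX A₁ hcm₁ hadd₁ ht₁ hirr₁ D₁
  -- coefficient relations
  have r₁ := fun n ↦ cuspCoeff_rel_of_twist_negThree hadd hadd₁ hiso₁ D D₁ n
  have r₂ := fun n ↦ cuspCoeff_rel_of_twist_negThree hadd₁ hadd₂ hiso₂ D₁ D₂ n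
  set χ₀ : DirichletCharacter ℂ 3 := (quadraticChar (ZMod 3)).ringHomComp (Int.castRingHom ℂ) with hχ₀
  have hχ0sq : ∀ n : ℕ, ∀ x : ℂ, χ₀ n * (χ₀ n * x) = x ∨ χ₀ n = 0 := by
    intro n x
    rcases hχ n with h0 | h1 | h1
    · exact Or.inr h0
    · left; rw [h1]; ring
    · left; rw [h1]; ring
  have h9₁ : 3 ^ 2 ∣ A₁.conductorNorm ℤ := hN₁ ▸ h9
  have h9₂ : 3 ^ 2 ∣ A₂.conductorNorm ℤ := (hN₂.trans hN₁) ▸ h9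
  rcases TwistPairAtThree.padicValInt_eq_three_or_nine_of_subTprime W hadd ht with h3 | h9'
  · -- `W` of type III: the type-III optimal member is `A₂ ∼ W`, partner `A₁`
    have h3₂ : padicValInt 3 A₂.minimalDiscriminantInt = 3 := by omega
    obtain ⟨DS, hexS, hminS, hfS⟩ := exists_transport_datum hN₂.symm D₁ hex₁ hmin₁
    have hf : DS.f = charTwist (A₂.conductorNorm ℤ) (dvd_refl _) h9₂ hχ D₂.f := by
      refine eq_of_forall_cuspCoeff_eq_gamma0 fun n ↦ ?_
      rw [hfS n, cuspCoeff_charTwist _ _ _ hχ hprim, (r₂ n).1]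
    have key := hP A₂ hcm₂ hadd₂ ht₂ hirr₂ h3₂ D₂ hex₂ hmin₂ h9₂ χ₀ hχ hprim A₁ DS hf hexS hminS
    -- `Λ(D.f) = Λ(D₂.f)` and `Λ(D.f ⊗ χ) = Λ(D₂.f ⊗ χ)` (`(f ⊗ χ) ⊗ χ = f` on `(t′)`)
    have hDD₂ : ∀ n : ℕ, cuspCoeff D.f n = cuspCoeff D₂.f n := by
      intro n
      rcases hχ0sq n (cuspCoeff D₂.f n) with h | h
      · rw [(r₁ n).1, (r₂ n).1, h]
      · rw [(r₁ n).1, (r₂ n).2, h, zero_mul]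
    have hL1 : periodLattice D.f = periodLattice D₂.f :=
      periodLattice_eq_of_level_eq_of_cuspCoeff_eq (hN₂.trans hN₁).symm D.f D₂.f hDD₂
    have hL2 : periodLattice (charTwist (W.conductorNorm ℤ) (dvd_refl _) h9 hχ D.f) =
        periodLattice (charTwist (A₂.conductorNorm ℤ) (dvd_refl _) h9₂ hχ D₂.f) :=
      periodLattice_eq_of_level_eq_of_cuspCoeff_eq (hN₂.trans hN₁).symm _ _ fun n ↦ by
        rw [cuspCoeff_charTwist _ _ _ hχ hprim, cuspCoeff_charTwist _ _ _ hχ hprim, hDD₂ n]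
    rw [hL1, hL2]
    exact key
  · -- `W` of type III*: the type-III optimal member is `A₁ ∼ W ⊗ χ₋₃`, partner `A₂ ∼ W`; disjuncts swap
    have h3₁ : padicValInt 3 A₁.minimalDiscriminantInt = 3 := by omega
    obtain ⟨DS, hexS, hminS, hfS⟩ := exists_transport_datum hN₂ D₂ hex₂ hmin₂
    have hf : DS.f = charTwist (A₁.conductorNorm ℤ) (dvd_refl _) h9₁ hχ D₁.f := by
      refine eq_of_forall_cuspCoeff_eq_gamma0 fun n ↦ ?_
      rw [hfS n, cuspCoeff_charTwist _ _ _ hχ hprim, (r₂ n).2]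
    have key := hP A₁ hcm₁ hadd₁ ht₁ hirr₁ h3₁ D₁ hex₁ hmin₁ h9₁ χ₀ hχ hprim A₂ DS hf hexS hminS
    have hL1 : periodLattice D₁.f = periodLattice (charTwist (W.conductorNorm ℤ) (dvd_refl _) h9 hχ D.f) :=
      periodLattice_eq_of_level_eq_of_cuspCoeff_eq hN₁ _ _ fun n ↦ by rw [cuspCoeff_charTwist _ _ _ hχ hprim, (r₁ n).2]
    have hL2 : periodLattice (charTwist (A₁.conductorNorm ℤ) (dvd_refl _) h9₁ hχ D₁.f) = periodLattice D.f :=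
      periodLattice_eq_of_level_eq_of_cuspCoeff_eq hN₁ _ _ fun n ↦ by
        rw [cuspCoeff_charTwist _ _ _ hχ hprim]
        rcases hχ0sq n (cuspCoeff D.f n) with h | h
        · rw [(r₁ n).2, h]
        · rw [h, zero_mul, (r₁ n).1, h, zero_mul]
    rw [hL1, hL2] at key
    rcases key with h | h
    · exact Or.inr h
    · exact Or.inl h

/-- **Corollary.** D24 granted modularity and Dokchitser–Dokchitser (the route's two cite-only facts), T24L and M25. -/
theorem tprimeIrrTwistLatticeDichotomy_of_facts (hnf : exists_isNewformOf)
    (hDD : dokchitser_padicValInt_minimalDiscriminantInt_eq_of_isogeny_of_not_dvd_degree)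
    (hT : TprimeIrrOptimalTwistNeronLattice) (hM : TprimeIrrTwistPairManinDivisibility) :
    TprimeIrrTwistLatticeDichotomy :=
  tprimeIrrTwistLatticeDichotomy_of_partner_of_optimalTwist
    (tprimeIrrTwistPartnerOptimalDatum_of_modularity_of_dokchitser hnf hDD) hT hM

end PartB


/-- **GD26 (stmt-BirchSwinnertonDyer-23051) PROVED BY NAME.** The route item
`TprimeIrrTwistLatticeDichotomyOfOptimalTwist : X22 → T24L → M25 → D24` is exactly
`tprimeIrrTwistLatticeDichotomy_of_partner_of_optimalTwist` (Part B above). No summit is proved; BSD is NOT proved. -/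
theorem tprimeIrrTwistLatticeDichotomyOfOptimalTwist_proof :
    TprimeIrrTwistLatticeDichotomyOfOptimalTwist :=
  tprimeIrrTwistLatticeDichotomy_of_partner_of_optimalTwist

/-- **D24 `TprimeIrrTwistLatticeDichotomy` (stmt-22544) GRANTED the two published facts only** (modularity,
Dokchitser–Dokchitser 2015 Thm. 5.1 (1)): T24L and M25 are theorems of the tree
(`tprimeIrrOptimalTwistNeronLattice_proof`, `tprimeIrrTwistPairManinDivisibility_proof`, LINE 25 chain proved outright).
[cite: DokchitserDokchitser2015LocalInvariants, Thm. 5.1 (1)] [cite: BCDTJAMS2001, Thm. A] -/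
theorem tprimeIrrTwistLatticeDichotomy_of_modularity_of_dokchitser
    (hnf : Literature.NumberTheory.EllipticCurves.ModularForms.exists_isNewformOf)
    (hDD : Literature.NumberTheory.EllipticCurves.dokchitser_padicValInt_minimalDiscriminantInt_eq_of_isogeny_of_not_dvd_degree) :
    TprimeIrrTwistLatticeDichotomy :=
  tprimeIrrTwistLatticeDichotomy_of_facts hnf hDD tprimeIrrOptimalTwistNeronLattice_proof
    tprimeIrrTwistPairManinDivisibility_proof

end Summit.BirchSwinnertonDyer.BirchSwinnertonDyer.Theorems.TameQuarticManinParity
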